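import Mathlib
import HarnessLib
import Literature.NumberTheory.GaloisRepresentations.OrdinaryGaloisRep
import Literature.NumberTheory.GaloisRepresentations.StableLattice
import Literature.NumberTheory.GaloisRepresentations.ResidualRepresentation
import Literature.NumberTheory.GaloisRepresentations.AbsolutelyIrreducibleReduction
import Literature.NumberTheory.GaloisRepresentations.AbsGaloisGroup

/-!
# Stub `stub_residualFlattening` of crux `EisensteinSeededLifting` (route `EisensteinDegreeShift`,
item stmt-Langlands-18369, line `birth`)

**Residual flattening over `𝒪_{ℚ̄_p}`** (pure valuation theory).  Let `O` be the valuation ring of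
`ℚ̄_p = PadicAlgCl p`, `ρ : Γ_K →ₜ* GL_n(ℚ̄_p)` and `ρ₀ : Γ_K → GL_n(O)` a residually upper-triangular
integral model of `ρ` in the same frame.  Then there is a change of frame `P ∈ GL_n(ℚ̄_p)` such that
`ρ' := P ρ P⁻¹` has an integral model `ρ₀'` (in its frame) all of whose off-diagonal entries lie in
the maximal ideal `𝔪` and whose diagonal entries agree with those of `ρ₀`.

Proof.  `𝔪 = {‖x‖ < 1}` and `O = {‖x‖ ≤ 1}`.  By compactness of `Γ_K` and continuity of `ρ`,
`c := sup_g max_{j<i} ‖(ρ g)ᵢⱼ‖ < 1`.  The value group of `ℚ̄_p` is `p^ℚ`, so there is `μ` (an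
`m`-th root of `p`) with `c < ‖μ‖^(n-1)` and `‖μ‖ < 1`.  Conjugating by
`P := diag(μ^0, μ^{-1}, …, μ^{-(n-1)})` multiplies the `(i,j)` entry by `μ^(j-i)`: entries above the
diagonal acquire norm `≤ ‖μ‖^(j-i) < 1`, entries below keep norm `≤ c ‖μ‖^{-(i-j)} < 1`, the diagonal
is unchanged.  Hence `ρ'` is `O`-integral (so lifts to `GL_n(O)`), residually diagonal, with the
same diagonal as `ρ₀`.
-/

set_option linter.dupNamespace false -- Summit.Langlands.Langlands is the mandated namespace

namespace Summit.Langlands.Langlands.Cruxes.EisensteinSeededLifting.Birth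

open scoped MatrixGroups
open Literature.NumberTheory.GaloisRepresentations IsLocalRing Field

/-- Density of the value group of `ℚ̄_p`: for every real `c < 1` and every `k : ℕ` there is
`μ ∈ ℚ̄_p` with `c < ‖μ‖ ^ k` and `‖μ‖ < 1` (take `μ` an `m`-th root of `p`, `m ≫ 0`). [folklore] -/
theorem exists_norm_lt_one_lt_pow (p : ℕ) [Fact p.Prime] {c : ℝ} (hc : c < 1) (k : ℕ) :
    ∃ μ : PadicAlgCl p, μ ≠ 0 ∧ ‖μ‖ < 1 ∧ c < ‖μ‖ ^ k := by
  -- `‖p‖ = p⁻¹` in `ℚ̄_p` (landed as `…SplitRamifiedPrimeSqrt6.padicAlgCl_norm_natCast_self`; one `rw`)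
  have hnp : ‖(p : PadicAlgCl p)‖ = (p : ℝ)⁻¹ := by
    rw [← map_natCast (algebraMap ℚ_[p] (PadicAlgCl p)), norm_algebraMap', Padic.norm_p]
  have hp : (p : ℝ)⁻¹ < 1 := by
    have h1 : (1 : ℝ) < p := by exact_mod_cast (Fact.out : p.Prime).one_lt
    exact inv_lt_one_of_one_lt₀ h1
  have hp0 : (0 : ℝ) < (p : ℝ)⁻¹ := by
    have h0 : (0 : ℝ) < p := by exact_mod_cast (Fact.out : p.Prime).pos
    exact inv_pos.2 h0
  -- the target `(p⁻¹)^k > 0`; choose `m` with `c^m < (p⁻¹)^k` (possible as `c < 1`)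
  by_cases hc0 : c < 0
  · refine ⟨p, ?_, ?_, ?_⟩
    · exact_mod_cast (Fact.out : p.Prime).ne_zero
    · rw [hnp]; exact hp
    · exact hc0.trans_le (pow_nonneg (norm_nonneg _) _)
  push Not at hc0
  obtain ⟨m, hm⟩ := exists_pow_lt_of_lt_one (pow_pos hp0 k) hc
  have hmpos : 0 < m := by
    rcases Nat.eq_zero_or_pos m with rfl | h
    · rw [pow_zero] at hm
      exact absurd hm (not_lt.2 (pow_le_one₀ hp0.le hp.le))
    · exact h
  obtain ⟨z, hz⟩ := IsAlgClosed.exists_pow_nat_eq (p : PadicAlgCl p) hmpos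
  have hzn : ‖z‖ ^ m = (p : ℝ)⁻¹ := by rw [← norm_pow, hz, hnp]
  have hz0 : z ≠ 0 := by
    rintro rfl
    rw [zero_pow hmpos.ne'] at hz
    exact (Nat.cast_ne_zero.2 (Fact.out : p.Prime).ne_zero) hz.symm
  refine ⟨z, hz0, ?_, ?_⟩
  · exact (pow_lt_one_iff_of_nonneg (norm_nonneg z) hmpos.ne').1 (hzn ▸ hp)
  · refine lt_of_pow_lt_pow_left₀ m (pow_nonneg (norm_nonneg _) _) ?_
    rw [← pow_mul, mul_comm, pow_mul, hzn]
    exact hm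

/-- **Residual flattening over `𝒪_{ℚ̄_p}`** — registered stub `stub_residualFlattening` of the
birth skeleton of crux `EisensteinSeededLifting` (statement verbatim). [folklore] -/
theorem stub_residualFlattening : ∀ (K : Type) [Field K] [NumberField K] (n : ℕ) (p : ℕ) [Fact p.Prime] (O : ValuationSubring (PadicAlgCl p)), O = (Valued.v : Valuation (PadicAlgCl p) NNReal).valuationSubring → ∀ (ρ : Literature.NumberTheory.GaloisRepresentations.FramedGaloisRep K (PadicAlgCl p) n) (ρ₀ : Field.absoluteGaloisGroup K →* GL (Fin n) O), ρ.HasUpperTriangularIntegralModel ρ₀ → ∃ (P : GL (Fin n) (PadicAlgCl p)) (ρ' : Literature.NumberTheory.GaloisRepresentations.FramedGaloisRep K (PadicAlgCl p) n) (ρ₀' : Field.absoluteGaloisGroup K →* GL (Fin n) O), ρ' = Literature.NumberTheory.GaloisRepresentations.FramedRep.conj P ρ ∧ ρ'.HasUpperTriangularIntegralModel ρ₀' ∧ (∀ (g : Field.absoluteGaloisGroup K) (i j : Fin n), i ≠ j → (ρ₀' g).val i j ∈ IsLocalRing.maximalIdeal O) ∧ (∀ (g : Field.absoluteGaloisGroup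 K) (i : Fin n), ((ρ₀' g).val i i - (ρ₀ g).val i i : O) ∈ IsLocalRing.maximalIdeal O) := by
  intro K _ _ n p _ O hO ρ ρ₀ hut
  -- (0) `O` is the closed unit ball, `𝔪` the open unit ball
  have hO' : ∀ x : PadicAlgCl p, x ∈ O ↔ ‖x‖ ≤ 1 := fun x => by
    rw [hO]; exact padicAlgCl_mem_valuationSubring_iff p x
  have hmax : ∀ x : O, x ∈ maximalIdeal O ↔ ‖(x : PadicAlgCl p)‖ < 1 :=
    mem_maximalIdeal_iff_norm_lt_one hO'
  -- entries of `ρ` are those of `ρ₀`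
  have hent : ∀ (g : absoluteGaloisGroup K) (i j : Fin n),
      (((ρ₀ g).val i j : O) : PadicAlgCl p) = (ρ g).val i j := by
    intro g i j
    rw [← hut.1 g]
    rfl
  have hle1 : ∀ (g : absoluteGaloisGroup K) (i j : Fin n), ‖(ρ g).val i j‖ ≤ 1 := by
    intro g i j
    rw [← hent]
    exact (hO' _).1 ((ρ₀ g).val i j).2
  have hlt1 : ∀ (g : absoluteGaloisGroup K) (i j : Fin n), j < i → ‖(ρ g).val i j‖ < 1 := by
    intro g i j hji
    rw [← hent]
    exact (hmax _).1 (hut.2 g i j hji)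
  -- (1) a uniform bound `c < 1` below the diagonal (compactness of `Γ_K`)
  have hcont : ∀ ij : Fin n × Fin n,
      Continuous fun g : absoluteGaloisGroup K => ‖(ρ g).val ij.1 ij.2‖₊ := fun ij =>
    ((Units.continuous_val.comp (map_continuous ρ)).matrix_elem ij.1 ij.2).nnnorm
  have hmaxOn : ∀ ij : Fin n × Fin n, ∃ g₀ : absoluteGaloisGroup K,
      ∀ g, ‖(ρ g).val ij.1 ij.2‖₊ ≤ ‖(ρ g₀).val ij.1 ij.2‖₊ := by
    intro ij
    obtain ⟨g₀, -, hg₀⟩ :=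
      isCompact_univ.exists_isMaxOn Set.univ_nonempty (hcont ij).continuousOn
    exact ⟨g₀, fun g => isMaxOn_iff.1 hg₀ g (Set.mem_univ g)⟩
  choose gmax hgmax using hmaxOn
  set S : Finset (Fin n × Fin n) := Finset.univ.filter (fun ij => ij.2 < ij.1) with hS
  set c : NNReal := S.sup (fun ij => ‖(ρ (gmax ij)).val ij.1 ij.2‖₊) with hc
  have hc1 : c < 1 := by
    rw [hc, Finset.sup_lt_iff (bot_le.trans_lt zero_lt_one)]
    intro ij hij
    rw [hS, Finset.mem_filter] at hij
    have h := hlt1 (gmax ij) ij.1 ij.2 hij.2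
    rw [← coe_nnnorm] at h
    exact_mod_cast h
  have hbound : ∀ (g : absoluteGaloisGroup K) (i j : Fin n), j < i → ‖(ρ g).val i j‖ ≤ c := by
    intro g i j hji
    have h1 : ‖(ρ g).val i j‖₊ ≤ c :=
      (hgmax (i, j) g).trans
        (Finset.le_sup (f := fun ij => ‖(ρ (gmax ij)).val ij.1 ij.2‖₊)
          (by rw [hS, Finset.mem_filter]; exact ⟨Finset.mem_univ _, hji⟩))
    rw [← coe_nnnorm]
    exact_mod_cast h1
  have hc1' : (c : ℝ) < 1 := by exact_mod_cast hc1
  -- (2) the scaling parameter `μ`: `‖μ‖ < 1`, `c < ‖μ‖ ^ (n - 1)`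
  obtain ⟨μ, hμ0, hμ1, hμc⟩ := exists_norm_lt_one_lt_pow p hc1' (n - 1)
  have ht0 : ‖μ‖ ≠ 0 := norm_ne_zero_iff.2 hμ0
  have htpos : 0 < ‖μ‖ := norm_pos_iff.2 hμ0
  -- (3) the frame `P = diag(μ^{-i})`, `P⁻¹ = diag(μ^i)`
  set d : Fin n → PadicAlgCl p := fun i => μ⁻¹ ^ (i : ℕ) with hd
  set e : Fin n → PadicAlgCl p := fun i => μ ^ (i : ℕ) with he
  have hde : ∀ i, d i * e i = 1 := by
    intro i
    rw [hd, he]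
    dsimp only
    rw [← mul_pow, inv_mul_cancel₀ hμ0, one_pow]
  have hed : ∀ i, e i * d i = 1 := fun i => by rw [mul_comm]; exact hde i
  let P : GL (Fin n) (PadicAlgCl p) :=
    ⟨Matrix.diagonal d, Matrix.diagonal e,
      by rw [Matrix.diagonal_mul_diagonal, ← Matrix.diagonal_one]; exact congrArg _ (funext hde),
      by rw [Matrix.diagonal_mul_diagonal, ← Matrix.diagonal_one]; exact congrArg _ (funext hed)⟩
  set ρ' : FramedGaloisRep K (PadicAlgCl p) n := FramedRep.conj P ρ with hρ'
  have hconj : ∀ (g : absoluteGaloisGroup K) (i j : Fin n),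
      (ρ' g).val i j = (ρ g).val i j * (d i * e j) := by
    intro g i j
    rw [hρ', FramedRep.conj_apply, Units.val_mul, Units.val_mul]
    change (Matrix.diagonal d * (ρ g).val * Matrix.diagonal e) i j = _
    rw [Matrix.mul_diagonal, Matrix.diagonal_mul]
    ring
  have hde_le : ∀ i j : Fin n, i ≤ j → d i * e j = μ ^ ((j : ℕ) - i) := by
    intro i j hij
    obtain ⟨k, hk⟩ := Nat.exists_eq_add_of_le (Fin.le_def.1 hij)
    rw [hd, he]
    dsimp only
    rw [hk, pow_add, ← mul_assoc, ← mul_pow, inv_mul_cancel₀ hμ0, one_pow, one_mul,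
      Nat.add_sub_cancel_left]
  have hde_gt : ∀ i j : Fin n, j < i → d i * e j = μ⁻¹ ^ ((i : ℕ) - j) := by
    intro i j hji
    obtain ⟨k, hk⟩ := Nat.exists_eq_add_of_le (Fin.le_def.1 hji.le)
    rw [hd, he]
    dsimp only
    rw [hk, pow_add, Nat.add_sub_cancel_left, mul_right_comm, ← mul_pow, inv_mul_cancel₀ hμ0,
      one_pow, one_mul]
  -- entry estimates for `ρ'`
  have hdiag : ∀ (g : absoluteGaloisGroup K) (i : Fin n), (ρ' g).val i i = (ρ g).val i i := by
    intro g i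
    rw [hconj, hde, mul_one]
  have hoff : ∀ (g : absoluteGaloisGroup K) (i j : Fin n), i ≠ j → ‖(ρ' g).val i j‖ < 1 := by
    intro g i j hij
    rcases lt_or_gt_of_ne hij with hlt | hgt
    · -- above the diagonal: `‖x μ^(j-i)‖ ≤ ‖μ‖^(j-i) < 1`
      rw [hconj, hde_le i j hlt.le, norm_mul, norm_pow]
      calc ‖(ρ g).val i j‖ * ‖μ‖ ^ ((j : ℕ) - i) ≤ 1 * ‖μ‖ ^ ((j : ℕ) - i) := by
            gcongr; exact hle1 g i j
        _ < 1 := by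
            rw [one_mul]
            exact pow_lt_one₀ (norm_nonneg _) hμ1 (Nat.sub_ne_zero_of_lt (Fin.lt_def.1 hlt))
    · -- below the diagonal: `‖x μ^{-(i-j)}‖ ≤ c ‖μ‖^{-(i-j)} < ‖μ‖^(i-j) ‖μ‖^{-(i-j)} = 1`
      rw [hconj, hde_gt i j hgt, norm_mul, norm_pow, norm_inv]
      have hij' : (i : ℕ) - j ≤ n - 1 := by have := i.isLt; omega
      have hcpow : (c : ℝ) < ‖μ‖ ^ ((i : ℕ) - j) :=
        hμc.trans_le (pow_le_pow_of_le_one (norm_nonneg _) hμ1.le hij')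
      calc ‖(ρ g).val i j‖ * ‖μ‖⁻¹ ^ ((i : ℕ) - j) ≤ c * ‖μ‖⁻¹ ^ ((i : ℕ) - j) := by
            gcongr; exact hbound g i j hgt
        _ < ‖μ‖ ^ ((i : ℕ) - j) * ‖μ‖⁻¹ ^ ((i : ℕ) - j) :=
            mul_lt_mul_of_pos_right hcpow (pow_pos (inv_pos.2 htpos) _)
        _ = 1 := by rw [← mul_pow, mul_inv_cancel₀ ht0, one_pow]
  have hall : ∀ (g : absoluteGaloisGroup K) (i j : Fin n), ‖(ρ' g).val i j‖ ≤ 1 := by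
    intro g i j
    by_cases hij : i = j
    · subst hij
      rw [hdiag]
      exact hle1 g i i
    · exact (hoff g i j hij).le
  -- (4) the integral model of `ρ'`
  have hrange : ∀ g : absoluteGaloisGroup K,
      ρ' g ∈ (Matrix.GeneralLinearGroup.map (n := Fin n) O.subtype).range := by
    intro g
    rw [mem_range_generalLinearGroup_map_iff]
    refine ⟨fun i j => (hO' _).2 (hall g i j), fun i j => ?_⟩
    rw [← map_inv]
    exact (hO' _).2 (hall g⁻¹ i j)
  obtain ⟨ρ₀', hρ₀'⟩ := exists_monoidHom_map_eq (O := O) ρ'.toMonoidHom (fun g => hrange g)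
  have hρ₀'' : ∀ g : absoluteGaloisGroup K,
      Matrix.GeneralLinearGroup.map O.subtype (ρ₀' g) = ρ' g := fun g => hρ₀' g
  have hent' : ∀ (g : absoluteGaloisGroup K) (i j : Fin n),
      (((ρ₀' g).val i j : O) : PadicAlgCl p) = (ρ' g).val i j := by
    intro g i j
    rw [← hρ₀'' g]
    rfl
  have hoff' : ∀ (g : absoluteGaloisGroup K) (i j : Fin n), i ≠ j →
      (ρ₀' g).val i j ∈ maximalIdeal O := by
    intro g i j hij
    rw [hmax, hent']
    exact hoff g i j hij
  refine ⟨P, ρ', ρ₀', rfl, ⟨hρ₀'', fun g i j hji => hoff' g i j hji.ne'⟩, hoff', ?_⟩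
  intro g i
  have hdi : (ρ₀' g).val i i = (ρ₀ g).val i i :=
    Subtype.ext (by rw [hent', hdiag, hent])
  rw [hdi, sub_self]
  exact Ideal.zero_mem _

end Summit.Langlands.Langlands.Cruxes.EisensteinSeededLifting.Birth
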